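import Literature.Analysis.Calculus.ApproximatesLinearHausdorff
import Mathlib.MeasureTheory.Function.Jacobian
import HarnessLib

/-!
# The area formula in positive codimension, for maps with injective differential

Brick R6 of the proof of the named fact
`Literature.Geometry.Kaehler.Harvey1977_boundary_toCurrent_eq_zero` (Stokes on the regular part
of a holomorphic chain, which is integrated against the Hausdorff measure `𝓗^{2p}`). Everything
is proved from Mathlib and `ApproximatesLinearHausdorff.lean`; no definitions, no named facts.

Let `P`, `V` be finite-dimensional real inner product spaces, `d = dim P`, `s ⊆ P` measurable,
`f : P → V` with `HasFDerivWithinAt f (f' x) s x` and `f' x` injective for every `x ∈ s`, and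
`J(A) = LinearMap.normDet A` the `d`-dimensional Jacobian (Mathlib). With Lebesgue measure on `P`
and the Euclidean Hausdorff measure `𝓗ᵈ = μHE[d]` on `V`:

* `euclideanHausdorffMeasure_image_le_lintegral_normDet` — `𝓗ᵈ(f(s)) ≤ ∫_s J(f' x) dx`;
* `lintegral_normDet_eq_euclideanHausdorffMeasure_image` — **`∫_s J(f' x) dx = 𝓗ᵈ(f(s))`**
  if moreover `f` is injective on `s` (Federer 3.2.3 (1), first case of the proof, `N = 1`);
* `restrict_map_withDensity_normDet`, `lintegral_image_eq_lintegral_normDet_mul`,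
  `integrableOn_image_iff_integrableOn_normDet_smul`,
  `integral_image_eq_integral_normDet_smul` — the change of variables
  **`∫_{f(s)} g d𝓗ᵈ = ∫_s J(f' x) g(f x) dx`** (Federer 3.2.5 for injective `f`).

The proof is Federer's (3.2.3, "First we consider the case when `A ⊂ {x : Df(x) is univalent}`"),
organised exactly as Mathlib's `Mathlib.MeasureTheory.Function.Jacobian` (the case `V = P`,
`J = |det|`): a countable measurable partition of `s` into pieces on which `f` is
`δ`-approximately linear (`exists_partition_approximatesLinearOn_of_hasFDerivWithinAt`), the
two-sided estimates `(1 ∓ Kδ)^{±d}` of `ApproximatesLinearHausdorff.lean` on each piece, the a.e.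
bound `‖f' x - A‖ ≤ δ` at density points (`norm_fderiv_sub_le_of_approximatesLinearOn`, Mathlib's
`ApproximatesLinearOn.norm_fderiv_sub_le` for a general codomain), and `ε → 0`. The singular part
of 3.2.3 (`Df` not injective) is not needed here and not treated (see
`Literature/Analysis/Calculus/LipschitzSardHausdorff.lean`).

## References

* H. Federer, *Geometric Measure Theory*, Springer 1969, 3.2.3, 3.2.5 (held copy
  `lit book:federernd-geometric-measure-theory`, PDF pp. 206–209).
-/

noncomputable section

open MeasureTheory MeasureTheory.Measure Set Function Filter Metric Module Topology Asymptotics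
  TopologicalSpace
open scoped ENNReal NNReal Pointwise

namespace Literature.Analysis.Calculus

/-! ### The derivative at density points of a piece (general codomain) -/

section NormFDeriv

variable {E : Type*} [NormedAddCommGroup E] [NormedSpace ℝ E] [FiniteDimensional ℝ E]
  [MeasurableSpace E] [BorelSpace E] (μ : Measure E) [μ.IsAddHaarMeasure]
  {F : Type*} [NormedAddCommGroup F] [NormedSpace ℝ F] {f : E → F} {s : Set E}

/-- If a differentiable map `f : E → F` is approximated by a linear map `A` on a set `s`, up to
`δ`, then at almost every `x ∈ s` one has `‖f' x - A‖ ≤ δ` (Mathlib's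
`ApproximatesLinearOn.norm_fderiv_sub_le`, whose proof is copied, for a general codomain `F`:
at a Lebesgue density point of `s` every direction is realised, up to `ε`, by points of `s`).
[folklore] -/
theorem norm_fderiv_sub_le_of_approximatesLinearOn {A : E →L[ℝ] F} {δ : ℝ≥0}
    (hf : ApproximatesLinearOn f A s δ) (hs : MeasurableSet s) (f' : E → E →L[ℝ] F)
    (hf' : ∀ x ∈ s, HasFDerivWithinAt f (f' x) s x) : ∀ᵐ x ∂μ.restrict s, ‖f' x - A‖₊ ≤ δ := by
  filter_upwards [Besicovitch.ae_tendsto_measure_inter_div μ s, ae_restrict_mem hs]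
  intro x hx xs
  apply ContinuousLinearMap.opNorm_le_bound _ δ.2 fun z => ?_
  suffices H : ∀ ε, 0 < ε → ‖(f' x - A) z‖ ≤ (δ + ε) * (‖z‖ + ε) + ‖f' x - A‖ * ε by
    have :
      Tendsto (fun ε : ℝ => ((δ : ℝ) + ε) * (‖z‖ + ε) + ‖f' x - A‖ * ε) (𝓝[>] 0)
        (𝓝 ((δ + 0) * (‖z‖ + 0) + ‖f' x - A‖ * 0)) :=
      Tendsto.mono_left (Continuous.tendsto (by fun_prop) 0) nhdsWithin_le_nhds
    simp only [add_zero, mul_zero] at this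
    apply le_of_tendsto_of_tendsto tendsto_const_nhds this
    filter_upwards [self_mem_nhdsWithin]
    exact H
  intro ε εpos
  have B₁ : ∀ᶠ r in 𝓝[>] (0 : ℝ), (s ∩ ({x} + r • closedBall z ε)).Nonempty :=
    eventually_nonempty_inter_smul_of_density_one μ s x hx _ measurableSet_closedBall
      (measure_closedBall_pos μ z εpos).ne'
  obtain ⟨ρ, ρpos, hρ⟩ :
    ∃ ρ > 0, ball x ρ ∩ s ⊆ {y : E | ‖f y - f x - (f' x) (y - x)‖ ≤ ε * ‖y - x‖} :=
    mem_nhdsWithin_iff.1 ((hf' x xs).isLittleO.def εpos)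
  have B₂ : ∀ᶠ r in 𝓝[>] (0 : ℝ), {x} + r • closedBall z ε ⊆ ball x ρ := by
    apply nhdsWithin_le_nhds
    exact eventually_singleton_add_smul_subset isBounded_closedBall (ball_mem_nhds x ρpos)
  obtain ⟨r, ⟨y, ⟨ys, hy⟩⟩, rρ, rpos⟩ :
    ∃ r : ℝ,
      (s ∩ ({x} + r • closedBall z ε)).Nonempty ∧ {x} + r • closedBall z ε ⊆ ball x ρ ∧ 0 < r :=
    (B₁.and (B₂.and self_mem_nhdsWithin)).exists
  obtain ⟨a, az, ya⟩ : ∃ a, a ∈ closedBall z ε ∧ y = x + r • a := by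
    simp only [mem_smul_set, image_add_left, mem_preimage, singleton_add] at hy
    rcases hy with ⟨a, az, ha⟩
    exact ⟨a, az, by simp only [ha, add_neg_cancel_left]⟩
  have norm_a : ‖a‖ ≤ ‖z‖ + ε :=
    calc
      ‖a‖ = ‖z + (a - z)‖ := by simp only [add_sub_cancel]
      _ ≤ ‖z‖ + ‖a - z‖ := norm_add_le _ _
      _ ≤ ‖z‖ + ε := by grw [mem_closedBall_iff_norm.1 az]
  have I : r * ‖(f' x - A) a‖ ≤ r * (δ + ε) * (‖z‖ + ε) :=
    calc
      r * ‖(f' x - A) a‖ = ‖(f' x - A) (r • a)‖ := by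
        simp only [map_smul, norm_smul, Real.norm_eq_abs, abs_of_nonneg rpos.le]
      _ = ‖f y - f x - A (y - x) - (f y - f x - (f' x) (y - x))‖ := by
        have : (f' x - A) (r • a) = (f' x) (r • a) - A (r • a) := rfl
        simp only [ya, add_sub_cancel_left, sub_sub_sub_cancel_left, this]
      _ ≤ ‖f y - f x - A (y - x)‖ + ‖f y - f x - (f' x) (y - x)‖ := norm_sub_le _ _
      _ ≤ δ * ‖y - x‖ + ε * ‖y - x‖ := (add_le_add (hf _ ys _ xs) (hρ ⟨rρ hy, ys⟩))
      _ = r * (δ + ε) * ‖a‖ := by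
        simp only [ya, add_sub_cancel_left, norm_smul, Real.norm_eq_abs, abs_of_nonneg rpos.le]
        ring
      _ ≤ r * (δ + ε) * (‖z‖ + ε) := by gcongr
  calc
    ‖(f' x - A) z‖ = ‖(f' x - A) a + (f' x - A) (z - a)‖ := by
      congr 1
      simp only [map_sub]
      abel
    _ ≤ ‖(f' x - A) a‖ + ‖(f' x - A) (z - a)‖ := norm_add_le _ _
    _ ≤ (δ + ε) * (‖z‖ + ε) + ‖f' x - A‖ * ‖z - a‖ := by
      apply add_le_add
      · rw [mul_assoc] at I; exact (mul_le_mul_iff_right₀ rpos).1 I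
      · apply ContinuousLinearMap.le_opNorm
    _ ≤ (δ + ε) * (‖z‖ + ε) + ‖f' x - A‖ * ε := by
      rw [mem_closedBall_iff_norm'] at az
      gcongr

/-- The derivative of a map `f : E → F` on a measurable set is almost everywhere measurable on
this set (Mathlib's `aemeasurable_fderivWithin`, whose proof is copied, for a general second
countable codomain `F`). [folklore] -/
theorem aemeasurable_fderivWithin_of_hasFDerivWithinAt [SecondCountableTopology F]
    {f' : E → E →L[ℝ] F} (hs : MeasurableSet s)
    (hf' : ∀ x ∈ s, HasFDerivWithinAt f (f' x) s x) : AEMeasurable f' (μ.restrict s) := by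
  refine aemeasurable_of_unif_approx fun ε εpos => ?_
  let δ : ℝ≥0 := ⟨ε, le_of_lt εpos⟩
  have δpos : 0 < δ := εpos
  obtain ⟨t, A, t_disj, t_meas, t_cover, ht, _⟩ :
    ∃ (t : ℕ → Set E) (A : ℕ → E →L[ℝ] F),
      Pairwise (Disjoint on t) ∧
        (∀ n : ℕ, MeasurableSet (t n)) ∧
          (s ⊆ ⋃ n : ℕ, t n) ∧
            (∀ n : ℕ, ApproximatesLinearOn f (A n) (s ∩ t n) δ) ∧
              (s.Nonempty → ∀ n, ∃ y ∈ s, A n = f' y) :=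
    exists_partition_approximatesLinearOn_of_hasFDerivWithinAt f s f' hf' (fun _ => δ) fun _ =>
      δpos.ne'
  obtain ⟨g, g_meas, hg⟩ :
      ∃ g : E → E →L[ℝ] F, Measurable g ∧ ∀ (n : ℕ) (x : E), x ∈ t n → g x = A n :=
    exists_measurable_piecewise t t_meas (fun n _ => A n) (fun n => measurable_const) <|
      t_disj.mono fun i j h => by simp only [h.inter_eq, eqOn_empty]
  refine ⟨g, g_meas.aemeasurable, ?_⟩
  suffices H : ∀ᵐ x : E ∂sum fun n ↦ μ.restrict (s ∩ t n), dist (g x) (f' x) ≤ ε by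
    have : μ.restrict s ≤ sum fun n => μ.restrict (s ∩ t n) := by
      have : s = ⋃ n, s ∩ t n := by
        rw [← inter_iUnion]
        exact Subset.antisymm (subset_inter Subset.rfl t_cover) inter_subset_left
      conv_lhs => rw [this]
      exact restrict_iUnion_le
    exact ae_mono this H
  refine ae_sum_iff.2 fun n => ?_
  have E₁ : ∀ᵐ x : E ∂μ.restrict (s ∩ t n), ‖f' x - A n‖₊ ≤ δ :=
    norm_fderiv_sub_le_of_approximatesLinearOn μ (ht n) (hs.inter (t_meas n)) f' fun x hx =>
      (hf' x hx.1).mono inter_subset_left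
  have E₂ : ∀ᵐ x : E ∂μ.restrict (s ∩ t n), g x = A n := by
    suffices H : ∀ᵐ x : E ∂μ.restrict (t n), g x = A n from
      ae_mono (restrict_mono inter_subset_right le_rfl) H
    filter_upwards [ae_restrict_mem (t_meas n)]
    exact hg n
  filter_upwards [E₁, E₂] with x hx1 hx2
  rw [← nndist_eq_nnnorm] at hx1
  rw [hx2, dist_comm]
  exact hx1

end NormFDeriv

/-! ### The area formula -/

section Area

variable {P : Type*} [NormedAddCommGroup P] [InnerProductSpace ℝ P] [FiniteDimensional ℝ P]
  [MeasurableSpace P] [BorelSpace P]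
  {V : Type*} [NormedAddCommGroup V] [InnerProductSpace ℝ V] [FiniteDimensional ℝ V]
  [MeasurableSpace V] [BorelSpace V]
  {f : P → V} {f' : P → P →L[ℝ] V} {s : Set P}

omit [MeasurableSpace V] [BorelSpace V] in
/-- `x ↦ J(f' x)` is a.e. measurable on `s`. [folklore] -/
theorem aemeasurable_ofReal_normDet_fderivWithin (hs : MeasurableSet s)
    (hf' : ∀ x ∈ s, HasFDerivWithinAt f (f' x) s x) :
    AEMeasurable (fun x => ENNReal.ofReal (f' x : P →ₗ[ℝ] V).normDet) (volume.restrict s) :=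
  measurable_ofReal_normDet.comp_aemeasurable
    (aemeasurable_fderivWithin_of_hasFDerivWithinAt volume hs hf')

omit [MeasurableSpace V] [BorelSpace V] in
/-- `x ↦ J(f' x)` as an `ℝ≥0`-valued function is a.e. measurable on `s`. [folklore] -/
theorem aemeasurable_toNNReal_normDet_fderivWithin (hs : MeasurableSet s)
    (hf' : ∀ x ∈ s, HasFDerivWithinAt f (f' x) s x) :
    AEMeasurable (fun x => ((f' x : P →ₗ[ℝ] V).normDet).toNNReal) (volume.restrict s) :=
  measurable_real_toNNReal.comp_aemeasurable (continuous_normDet.measurable.comp_aemeasurable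
    (aemeasurable_fderivWithin_of_hasFDerivWithinAt volume hs hf'))

omit [FiniteDimensional ℝ V] in
/-- If a map is differentiable and injective on a measurable set, then the image is measurable
(Lusin–Souslin, as Mathlib's `measurable_image_of_fderivWithin`). [folklore] -/
theorem measurableSet_image_of_hasFDerivWithinAt (hs : MeasurableSet s)
    (hf' : ∀ x ∈ s, HasFDerivWithinAt f (f' x) s x) (hf : InjOn f s) :
    MeasurableSet (f '' s) :=
  hs.image_of_continuousOn_injOn (fun x hx => (hf' x hx).continuousWithinAt) hf

omit [FiniteDimensional ℝ V] in
/-- If a map is differentiable and injective on a measurable set, then its restriction to it is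
a measurable embedding (as Mathlib's `measurableEmbedding_of_fderivWithin`). [folklore] -/
theorem measurableEmbedding_restrict_of_hasFDerivWithinAt (hs : MeasurableSet s)
    (hf' : ∀ x ∈ s, HasFDerivWithinAt f (f' x) s x) (hf : InjOn f s) :
    MeasurableEmbedding (s.restrict f) :=
  haveI : DifferentiableOn ℝ f s := fun x hx => (hf' x hx).differentiableWithinAt
  this.continuousOn.measurableEmbedding hs hf

/-- **Upper bound with controlled error**: `𝓗ᵈ(f(s)) ≤ ∫_s J(f' x) dx + 2 ε vol(s)` (the
analogue of Mathlib's `addHaar_image_le_lintegral_abs_det_fderiv_aux1`, whose proof is copied).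
[cite: Federer1969, 3.2.3 (proof)] -/
theorem euclideanHausdorffMeasure_image_le_lintegral_normDet_aux1 (hs : MeasurableSet s)
    (hf' : ∀ x ∈ s, HasFDerivWithinAt f (f' x) s x) (hinj : ∀ x ∈ s, Injective (f' x))
    {ε : ℝ≥0} (εpos : 0 < ε) :
    μHE[finrank ℝ P] (f '' s) ≤
      (∫⁻ x in s, ENNReal.ofReal (f' x : P →ₗ[ℝ] V).normDet) + 2 * ε * volume s := by
  rcases s.eq_empty_or_nonempty with rfl | hsne
  · simp
  have :
    ∀ A : P →L[ℝ] V,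
      ∃ δ : ℝ≥0,
        0 < δ ∧
          (∀ B : P →L[ℝ] V, ‖B - A‖ ≤ δ →
            |(B : P →ₗ[ℝ] V).normDet - (A : P →ₗ[ℝ] V).normDet| ≤ ε) ∧
            (Injective A → ∀ (t : Set P) (g : P → V), ApproximatesLinearOn g A t δ →
              μHE[finrank ℝ P] (g '' t) ≤
                (ENNReal.ofReal (A : P →ₗ[ℝ] V).normDet + ε) * volume t) := by
    intro A
    obtain ⟨δ', δ'pos, hδ'⟩ : ∃ (δ' : ℝ), 0 < δ' ∧ ∀ B : P →L[ℝ] V, dist B A < δ' →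
        dist (B : P →ₗ[ℝ] V).normDet (A : P →ₗ[ℝ] V).normDet < ↑ε :=
      continuousAt_iff.1 (continuous_normDet.continuousAt) ε εpos
    let δ'' : ℝ≥0 := ⟨δ' / 2, (half_pos δ'pos).le⟩
    have I'' : ∀ B : P →L[ℝ] V, ‖B - A‖ ≤ ↑δ'' →
        |(B : P →ₗ[ℝ] V).normDet - (A : P →ₗ[ℝ] V).normDet| ≤ ↑ε := by
      intro B hB
      rw [← Real.dist_eq]
      apply (hδ' B _).le
      rw [dist_eq_norm]
      exact hB.trans_lt (half_lt_self δ'pos)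
    by_cases hA : Injective A
    · let m : ℝ≥0 := Real.toNNReal (A : P →ₗ[ℝ] V).normDet + ε
      have I : ENNReal.ofReal (A : P →ₗ[ℝ] V).normDet < m := by
        simp only [m, ENNReal.ofReal, lt_add_iff_pos_right, εpos, ENNReal.coe_lt_coe]
      rcases ((euclideanHausdorffMeasure_image_le_mul_of_normDet_lt hA I).and
        self_mem_nhdsWithin).exists with ⟨δ, h, δpos⟩
      refine ⟨min δ δ'', lt_min δpos (half_pos δ'pos), ?_, ?_⟩
      · intro B hB
        apply I'' _ (hB.trans _)
        simp only [le_refl, NNReal.coe_min, min_le_iff, or_true]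
      · intro _ t g htg
        exact h t g (htg.mono_num (min_le_left _ _))
    · exact ⟨δ'', half_pos δ'pos, I'', fun h => (hA h).elim⟩
  choose δ hδ using this
  obtain ⟨t, A, t_disj, t_meas, t_cover, ht, hA⟩ :
    ∃ (t : ℕ → Set P) (A : ℕ → P →L[ℝ] V),
      Pairwise (Disjoint on t) ∧
        (∀ n : ℕ, MeasurableSet (t n)) ∧
          (s ⊆ ⋃ n : ℕ, t n) ∧
            (∀ n : ℕ, ApproximatesLinearOn f (A n) (s ∩ t n) (δ (A n))) ∧
              (s.Nonempty → ∀ n, ∃ y ∈ s, A n = f' y) :=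
    exists_partition_approximatesLinearOn_of_hasFDerivWithinAt f s f' hf' δ fun A => (hδ A).1.ne'
  have hAinj : ∀ n, Injective (A n) := fun n => by
    obtain ⟨y, ys, hy⟩ := hA hsne n
    rw [hy]
    exact hinj y ys
  calc
    μHE[finrank ℝ P] (f '' s) ≤ μHE[finrank ℝ P] (⋃ n, f '' (s ∩ t n)) := by
      apply measure_mono
      rw [← image_iUnion, ← inter_iUnion]
      exact Set.image_mono (subset_inter Subset.rfl t_cover)
    _ ≤ ∑' n, μHE[finrank ℝ P] (f '' (s ∩ t n)) := measure_iUnion_le _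
    _ ≤ ∑' n, (ENNReal.ofReal (A n : P →ₗ[ℝ] V).normDet + ε) * volume (s ∩ t n) := by
      apply ENNReal.tsum_le_tsum fun n => ?_
      apply (hδ (A n)).2.2 (hAinj n)
      exact ht n
    _ = ∑' n, ∫⁻ _ in s ∩ t n, ENNReal.ofReal (A n : P →ₗ[ℝ] V).normDet + ε := by
      simp only [lintegral_const, MeasurableSet.univ, Measure.restrict_apply, univ_inter]
    _ ≤ ∑' n, ∫⁻ x in s ∩ t n, ENNReal.ofReal (f' x : P →ₗ[ℝ] V).normDet + 2 * ε := by
      apply ENNReal.tsum_le_tsum fun n => ?_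
      apply lintegral_mono_ae
      filter_upwards [norm_fderiv_sub_le_of_approximatesLinearOn volume (ht n)
        (hs.inter (t_meas n)) f' fun x hx => (hf' x hx.1).mono inter_subset_left]
      intro x hx
      have I : (A n : P →ₗ[ℝ] V).normDet ≤ (f' x : P →ₗ[ℝ] V).normDet + ε :=
        calc
          (A n : P →ₗ[ℝ] V).normDet = (f' x : P →ₗ[ℝ] V).normDet -
              ((f' x : P →ₗ[ℝ] V).normDet - (A n : P →ₗ[ℝ] V).normDet) := by ring
          _ ≤ (f' x : P →ₗ[ℝ] V).normDet +
              |(f' x : P →ₗ[ℝ] V).normDet - (A n : P →ₗ[ℝ] V).normDet| :=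
            (sub_le_sub_left (neg_abs_le _) _).trans_eq (sub_neg_eq_add _ _)
          _ ≤ (f' x : P →ₗ[ℝ] V).normDet + ε := add_le_add le_rfl ((hδ (A n)).2.1 _ hx)
      calc
        ENNReal.ofReal (A n : P →ₗ[ℝ] V).normDet + ε ≤
            ENNReal.ofReal ((f' x : P →ₗ[ℝ] V).normDet + ε) + ε := by gcongr
        _ = ENNReal.ofReal (f' x : P →ₗ[ℝ] V).normDet + 2 * ε := by
          simp only [ENNReal.ofReal_add, LinearMap.normDet_nonneg, two_mul, add_assoc,
            NNReal.zero_le_coe, ENNReal.ofReal_coe_nnreal]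
    _ = ∫⁻ x in ⋃ n, s ∩ t n, ENNReal.ofReal (f' x : P →ₗ[ℝ] V).normDet + 2 * ε := by
      have M : ∀ n : ℕ, MeasurableSet (s ∩ t n) := fun n => hs.inter (t_meas n)
      rw [lintegral_iUnion M]
      exact pairwise_disjoint_mono t_disj fun n => inter_subset_right
    _ = ∫⁻ x in s, ENNReal.ofReal (f' x : P →ₗ[ℝ] V).normDet + 2 * ε := by
      rw [← inter_iUnion, inter_eq_self_of_subset_left t_cover]
    _ = (∫⁻ x in s, ENNReal.ofReal (f' x : P →ₗ[ℝ] V).normDet) + 2 * ε * volume s := by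
      simp only [lintegral_add_right' _ aemeasurable_const, setLIntegral_const]

/-- **Upper bound on finite-measure sets**: `𝓗ᵈ(f(s)) ≤ ∫_s J(f' x) dx` when `vol(s) < ∞`.
[cite: Federer1969, 3.2.3] -/
theorem euclideanHausdorffMeasure_image_le_lintegral_normDet_aux2 (hs : MeasurableSet s)
    (h's : volume s ≠ ∞) (hf' : ∀ x ∈ s, HasFDerivWithinAt f (f' x) s x)
    (hinj : ∀ x ∈ s, Injective (f' x)) :
    μHE[finrank ℝ P] (f '' s) ≤ ∫⁻ x in s, ENNReal.ofReal (f' x : P →ₗ[ℝ] V).normDet := by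
  have :
    Tendsto (fun ε : ℝ≥0 => (∫⁻ x in s, ENNReal.ofReal (f' x : P →ₗ[ℝ] V).normDet) +
        2 * ε * volume s) (𝓝[>] 0)
      (𝓝 ((∫⁻ x in s, ENNReal.ofReal (f' x : P →ₗ[ℝ] V).normDet) +
        2 * (0 : ℝ≥0) * volume s)) := by
    apply Tendsto.mono_left _ nhdsWithin_le_nhds
    refine tendsto_const_nhds.add ?_
    refine ENNReal.Tendsto.mul_const ?_ (Or.inr h's)
    exact ENNReal.Tendsto.const_mul (ENNReal.tendsto_coe.2 tendsto_id) (Or.inr ENNReal.coe_ne_top)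
  simp only [add_zero, zero_mul, mul_zero, ENNReal.coe_zero] at this
  apply ge_of_tendsto this
  filter_upwards [self_mem_nhdsWithin]
  intro ε εpos
  rw [mem_Ioi] at εpos
  exact euclideanHausdorffMeasure_image_le_lintegral_normDet_aux1 hs hf' hinj εpos

/-- **`𝓗ᵈ(f(s)) ≤ ∫_s J(f' x) dx`** for `f` differentiable on the measurable set `s` with
injective differential (exhaust `s` by finite-measure pieces). [cite: Federer1969, 3.2.3] -/
theorem euclideanHausdorffMeasure_image_le_lintegral_normDet (hs : MeasurableSet s)
    (hf' : ∀ x ∈ s, HasFDerivWithinAt f (f' x) s x) (hinj : ∀ x ∈ s, Injective (f' x)) :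
    μHE[finrank ℝ P] (f '' s) ≤ ∫⁻ x in s, ENNReal.ofReal (f' x : P →ₗ[ℝ] V).normDet := by
  let u n := disjointed (spanningSets (volume : Measure P)) n
  have u_meas : ∀ n, MeasurableSet (u n) := by
    intro n
    apply MeasurableSet.disjointed fun i => ?_
    exact measurableSet_spanningSets volume i
  have A : s = ⋃ n, s ∩ u n := by
    rw [← inter_iUnion, iUnion_disjointed, iUnion_spanningSets, inter_univ]
  calc
    μHE[finrank ℝ P] (f '' s) ≤ ∑' n, μHE[finrank ℝ P] (f '' (s ∩ u n)) := by
      conv_lhs => rw [A, image_iUnion]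
      exact measure_iUnion_le _
    _ ≤ ∑' n, ∫⁻ x in s ∩ u n, ENNReal.ofReal (f' x : P →ₗ[ℝ] V).normDet := by
      apply ENNReal.tsum_le_tsum fun n => ?_
      apply euclideanHausdorffMeasure_image_le_lintegral_normDet_aux2 (hs.inter (u_meas n)) _
        (fun x hx => (hf' x hx.1).mono inter_subset_left) fun x hx => hinj x hx.1
      have : volume (u n) < ∞ :=
        lt_of_le_of_lt (measure_mono (disjointed_subset _ _))
          (measure_spanningSets_lt_top volume n)
      exact ne_of_lt (lt_of_le_of_lt (measure_mono inter_subset_right) this)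
    _ = ∫⁻ x in s, ENNReal.ofReal (f' x : P →ₗ[ℝ] V).normDet := by
      conv_rhs => rw [A]
      rw [lintegral_iUnion]
      · intro n; exact hs.inter (u_meas n)
      · exact pairwise_disjoint_mono (disjoint_disjointed _) fun n => inter_subset_right

/-- **Lower bound with controlled error**: `∫_s J(f' x) dx ≤ 𝓗ᵈ(f(s)) + 2 ε vol(s)` for `f`
injective on `s` (the analogue of Mathlib's `lintegral_abs_det_fderiv_le_addHaar_image_aux1`,
whose proof is copied). [cite: Federer1969, 3.2.3 (proof)] -/
theorem lintegral_normDet_le_euclideanHausdorffMeasure_image_aux1 (hs : MeasurableSet s)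
    (hf' : ∀ x ∈ s, HasFDerivWithinAt f (f' x) s x) (hf : InjOn f s) {ε : ℝ≥0}
    (εpos : 0 < ε) :
    (∫⁻ x in s, ENNReal.ofReal (f' x : P →ₗ[ℝ] V).normDet) ≤
      μHE[finrank ℝ P] (f '' s) + 2 * ε * volume s := by
  have :
    ∀ A : P →L[ℝ] V,
      ∃ δ : ℝ≥0,
        0 < δ ∧
          (∀ B : P →L[ℝ] V, ‖B - A‖ ≤ δ →
            |(B : P →ₗ[ℝ] V).normDet - (A : P →ₗ[ℝ] V).normDet| ≤ ε) ∧
            ∀ (t : Set P) (g : P → V), ApproximatesLinearOn g A t δ →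
              ENNReal.ofReal (A : P →ₗ[ℝ] V).normDet * volume t ≤
                μHE[finrank ℝ P] (g '' t) + ε * volume t := by
    intro A
    obtain ⟨δ', δ'pos, hδ'⟩ : ∃ (δ' : ℝ), 0 < δ' ∧ ∀ B : P →L[ℝ] V, dist B A < δ' →
        dist (B : P →ₗ[ℝ] V).normDet (A : P →ₗ[ℝ] V).normDet < ↑ε :=
      continuousAt_iff.1 (continuous_normDet.continuousAt) ε εpos
    let δ'' : ℝ≥0 := ⟨δ' / 2, (half_pos δ'pos).le⟩
    have I'' : ∀ B : P →L[ℝ] V, ‖B - A‖ ≤ ↑δ'' →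
        |(B : P →ₗ[ℝ] V).normDet - (A : P →ₗ[ℝ] V).normDet| ≤ ↑ε := by
      intro B hB
      rw [← Real.dist_eq]
      apply (hδ' B _).le
      rw [dist_eq_norm]
      exact hB.trans_lt (half_lt_self δ'pos)
    by_cases hA : Injective A
    swap
    · refine ⟨δ'', half_pos δ'pos, I'', ?_⟩
      have h0 : (A : P →ₗ[ℝ] V).normDet = 0 :=
        LinearMap.normDet_eq_zero_iff_ker_ne_bot.2 fun h => hA (LinearMap.ker_eq_bot.1 h)
      simp only [h0, ENNReal.ofReal_zero, zero_mul, zero_le, imp_true_iff]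
    have hA0 : 0 < (A : P →ₗ[ℝ] V).normDet := by
      refine lt_of_le_of_ne (LinearMap.normDet_nonneg _) (Ne.symm ?_)
      rw [Ne, LinearMap.normDet_eq_zero_iff_ker_ne_bot, not_not]
      exact LinearMap.ker_eq_bot.2 hA
    let m : ℝ≥0 := Real.toNNReal (A : P →ₗ[ℝ] V).normDet - ε
    have I : (m : ℝ≥0∞) < ENNReal.ofReal (A : P →ₗ[ℝ] V).normDet := by
      simp only [m, ENNReal.ofReal, ENNReal.coe_sub]
      apply ENNReal.sub_lt_self ENNReal.coe_ne_top
      · simpa only [Real.toNNReal_eq_zero, ENNReal.coe_eq_zero, Ne, not_le] using hA0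
      · simp only [εpos.ne', ENNReal.coe_eq_zero, Ne, not_false_iff]
    rcases ((mul_le_euclideanHausdorffMeasure_image_of_lt_normDet hA I).and
      self_mem_nhdsWithin).exists with ⟨δ, h, δpos⟩
    refine ⟨min δ δ'', lt_min δpos (half_pos δ'pos), ?_, ?_⟩
    · intro B hB
      apply I'' _ (hB.trans _)
      simp only [le_refl, NNReal.coe_min, min_le_iff, or_true]
    · intro t g htg
      rcases eq_or_ne (volume t) ∞ with (ht | ht)
      · simp only [ht, εpos.ne', ENNReal.mul_top, ENNReal.coe_eq_zero, le_top, Ne,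
          not_false_iff, _root_.add_top]
      have := h t g (htg.mono_num (min_le_left _ _))
      rwa [ENNReal.coe_sub, ENNReal.sub_mul, tsub_le_iff_right] at this
      simp only [ht, imp_true_iff, Ne, not_false_iff]
  choose δ hδ using this
  obtain ⟨t, A, t_disj, t_meas, t_cover, ht, -⟩ :
    ∃ (t : ℕ → Set P) (A : ℕ → P →L[ℝ] V),
      Pairwise (Disjoint on t) ∧
        (∀ n : ℕ, MeasurableSet (t n)) ∧
          (s ⊆ ⋃ n : ℕ, t n) ∧
            (∀ n : ℕ, ApproximatesLinearOn f (A n) (s ∩ t n) (δ (A n))) ∧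
              (s.Nonempty → ∀ n, ∃ y ∈ s, A n = f' y) :=
    exists_partition_approximatesLinearOn_of_hasFDerivWithinAt f s f' hf' δ fun A => (hδ A).1.ne'
  have s_eq : s = ⋃ n, s ∩ t n := by
    rw [← inter_iUnion]
    exact Subset.antisymm (subset_inter Subset.rfl t_cover) inter_subset_left
  calc
    (∫⁻ x in s, ENNReal.ofReal (f' x : P →ₗ[ℝ] V).normDet) =
        ∑' n, ∫⁻ x in s ∩ t n, ENNReal.ofReal (f' x : P →ₗ[ℝ] V).normDet := by
      conv_lhs => rw [s_eq]
      rw [lintegral_iUnion]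
      · exact fun n => hs.inter (t_meas n)
      · exact pairwise_disjoint_mono t_disj fun n => inter_subset_right
    _ ≤ ∑' n, ∫⁻ _ in s ∩ t n, ENNReal.ofReal (A n : P →ₗ[ℝ] V).normDet + ε := by
      apply ENNReal.tsum_le_tsum fun n => ?_
      apply lintegral_mono_ae
      filter_upwards [norm_fderiv_sub_le_of_approximatesLinearOn volume (ht n)
        (hs.inter (t_meas n)) f' fun x hx => (hf' x hx.1).mono inter_subset_left]
      intro x hx
      have I : (f' x : P →ₗ[ℝ] V).normDet ≤ (A n : P →ₗ[ℝ] V).normDet + ε :=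
        calc
          (f' x : P →ₗ[ℝ] V).normDet = (A n : P →ₗ[ℝ] V).normDet +
              ((f' x : P →ₗ[ℝ] V).normDet - (A n : P →ₗ[ℝ] V).normDet) := by ring
          _ ≤ (A n : P →ₗ[ℝ] V).normDet +
              |(f' x : P →ₗ[ℝ] V).normDet - (A n : P →ₗ[ℝ] V).normDet| :=
            add_le_add le_rfl (le_abs_self _)
          _ ≤ (A n : P →ₗ[ℝ] V).normDet + ε := add_le_add le_rfl ((hδ (A n)).2.1 _ hx)
      calc
        ENNReal.ofReal (f' x : P →ₗ[ℝ] V).normDet ≤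
            ENNReal.ofReal ((A n : P →ₗ[ℝ] V).normDet + ε) := ENNReal.ofReal_le_ofReal I
        _ = ENNReal.ofReal (A n : P →ₗ[ℝ] V).normDet + ε := by
          simp only [ENNReal.ofReal_add, LinearMap.normDet_nonneg, NNReal.zero_le_coe,
            ENNReal.ofReal_coe_nnreal]
    _ = ∑' n, (ENNReal.ofReal (A n : P →ₗ[ℝ] V).normDet * volume (s ∩ t n) +
          ε * volume (s ∩ t n)) := by
      simp only [setLIntegral_const, lintegral_add_right _ measurable_const]
    _ ≤ ∑' n, (μHE[finrank ℝ P] (f '' (s ∩ t n)) + ε * volume (s ∩ t n) +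
          ε * volume (s ∩ t n)) := by
      gcongr with n
      exact (hδ (A n)).2.2 _ _ (ht n)
    _ = μHE[finrank ℝ P] (f '' s) + 2 * ε * volume s := by
      conv_rhs => rw [s_eq]
      rw [image_iUnion, measure_iUnion]; rotate_left
      · intro i j hij
        apply Disjoint.image _ hf inter_subset_left inter_subset_left
        exact Disjoint.mono inter_subset_right inter_subset_right (t_disj hij)
      · intro i
        exact
          measurableSet_image_of_hasFDerivWithinAt (hs.inter (t_meas i))
            (fun x hx => (hf' x hx.1).mono inter_subset_left) (hf.mono inter_subset_left)
      rw [measure_iUnion]; rotate_left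
      · exact pairwise_disjoint_mono t_disj fun i => inter_subset_right
      · exact fun i => hs.inter (t_meas i)
      rw [← ENNReal.tsum_mul_left, ← ENNReal.tsum_add]
      congr 1
      ext1 i
      rw [mul_assoc, two_mul, add_assoc]

/-- Lower bound on finite-measure sets. [cite: Federer1969, 3.2.3] -/
theorem lintegral_normDet_le_euclideanHausdorffMeasure_image_aux2 (hs : MeasurableSet s)
    (h's : volume s ≠ ∞) (hf' : ∀ x ∈ s, HasFDerivWithinAt f (f' x) s x) (hf : InjOn f s) :
    (∫⁻ x in s, ENNReal.ofReal (f' x : P →ₗ[ℝ] V).normDet) ≤ μHE[finrank ℝ P] (f '' s) := by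
  have :
    Tendsto (fun ε : ℝ≥0 => μHE[finrank ℝ P] (f '' s) + 2 * ε * volume s) (𝓝[>] 0)
      (𝓝 (μHE[finrank ℝ P] (f '' s) + 2 * (0 : ℝ≥0) * volume s)) := by
    apply Tendsto.mono_left _ nhdsWithin_le_nhds
    refine tendsto_const_nhds.add ?_
    refine ENNReal.Tendsto.mul_const ?_ (Or.inr h's)
    exact ENNReal.Tendsto.const_mul (ENNReal.tendsto_coe.2 tendsto_id) (Or.inr ENNReal.coe_ne_top)
  simp only [add_zero, zero_mul, mul_zero, ENNReal.coe_zero] at this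
  apply ge_of_tendsto this
  filter_upwards [self_mem_nhdsWithin]
  intro ε εpos
  rw [mem_Ioi] at εpos
  exact lintegral_normDet_le_euclideanHausdorffMeasure_image_aux1 hs hf' hf εpos

/-- **`∫_s J(f' x) dx ≤ 𝓗ᵈ(f(s))`** for `f` injective and differentiable on the measurable set
`s`. [cite: Federer1969, 3.2.3] -/
theorem lintegral_normDet_le_euclideanHausdorffMeasure_image (hs : MeasurableSet s)
    (hf' : ∀ x ∈ s, HasFDerivWithinAt f (f' x) s x) (hf : InjOn f s) :
    (∫⁻ x in s, ENNReal.ofReal (f' x : P →ₗ[ℝ] V).normDet) ≤ μHE[finrank ℝ P] (f '' s) := by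
  let u n := disjointed (spanningSets (volume : Measure P)) n
  have u_meas : ∀ n, MeasurableSet (u n) := by
    intro n
    apply MeasurableSet.disjointed fun i => ?_
    exact measurableSet_spanningSets volume i
  have A : s = ⋃ n, s ∩ u n := by
    rw [← inter_iUnion, iUnion_disjointed, iUnion_spanningSets, inter_univ]
  calc
    (∫⁻ x in s, ENNReal.ofReal (f' x : P →ₗ[ℝ] V).normDet) =
        ∑' n, ∫⁻ x in s ∩ u n, ENNReal.ofReal (f' x : P →ₗ[ℝ] V).normDet := by
      conv_lhs => rw [A]
      rw [lintegral_iUnion]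
      · intro n; exact hs.inter (u_meas n)
      · exact pairwise_disjoint_mono (disjoint_disjointed _) fun n => inter_subset_right
    _ ≤ ∑' n, μHE[finrank ℝ P] (f '' (s ∩ u n)) := by
      apply ENNReal.tsum_le_tsum fun n => ?_
      apply
        lintegral_normDet_le_euclideanHausdorffMeasure_image_aux2 (hs.inter (u_meas n)) _
          (fun x hx => (hf' x hx.1).mono inter_subset_left) (hf.mono inter_subset_left)
      have : volume (u n) < ∞ :=
        lt_of_le_of_lt (measure_mono (disjointed_subset _ _))
          (measure_spanningSets_lt_top volume n)
      exact ne_of_lt (lt_of_le_of_lt (measure_mono inter_subset_right) this)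
    _ = μHE[finrank ℝ P] (f '' s) := by
      conv_rhs => rw [A, image_iUnion]
      rw [measure_iUnion]
      · intro i j hij
        apply Disjoint.image _ hf inter_subset_left inter_subset_left
        exact
          Disjoint.mono inter_subset_right inter_subset_right
            (disjoint_disjointed _ hij)
      · intro i
        exact
          measurableSet_image_of_hasFDerivWithinAt (hs.inter (u_meas i))
            (fun x hx => (hf' x hx.1).mono inter_subset_left)
            (hf.mono inter_subset_left)

/-- **The area formula** (injective case): for `f` injective and differentiable on the
measurable set `s ⊆ P` with injective differential, **`∫_s J(f' x) dx = 𝓗ᵈ(f(s))`**,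
`d = dim P`, `J = normDet`, `𝓗ᵈ = μHE[d]` on `V` — Federer's 3.2.3 (1)
`∫_A J_m f dℒᵐ = ∫ N(f|A, y) d𝓗ᵐ y` with `N(f|A, ·) = 𝟙_{f(A)}`. [cite: Federer1969, 3.2.3 (1)] -/
theorem lintegral_normDet_eq_euclideanHausdorffMeasure_image (hs : MeasurableSet s)
    (hf' : ∀ x ∈ s, HasFDerivWithinAt f (f' x) s x) (hinj : ∀ x ∈ s, Injective (f' x))
    (hf : InjOn f s) :
    (∫⁻ x in s, ENNReal.ofReal (f' x : P →ₗ[ℝ] V).normDet) = μHE[finrank ℝ P] (f '' s) :=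
  le_antisymm (lintegral_normDet_le_euclideanHausdorffMeasure_image hs hf' hf)
    (euclideanHausdorffMeasure_image_le_lintegral_normDet hs hf' hinj)

/-! ### Change of variables in integrals -/

/-- Push-forward form of the area formula, for a measurable map `f`: the image under `f` of
`J(f') · vol ⌞ s` is `𝓗ᵈ ⌞ f(s)`. [cite: Federer1969, 3.2.3, 3.2.5] -/
theorem map_withDensity_normDet_eq_euclideanHausdorffMeasure (hs : MeasurableSet s)
    (hf' : ∀ x ∈ s, HasFDerivWithinAt f (f' x) s x) (hinj : ∀ x ∈ s, Injective (f' x))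
    (hf : InjOn f s) (hfm : Measurable f) :
    Measure.map f ((volume.restrict s).withDensity fun x =>
        ENNReal.ofReal (f' x : P →ₗ[ℝ] V).normDet) =
      (μHE[finrank ℝ P] : Measure V).restrict (f '' s) := by
  apply Measure.ext fun t ht => ?_
  have hft : MeasurableSet (f ⁻¹' t) := hfm ht
  rw [map_apply hfm ht, withDensity_apply _ hft, Measure.restrict_apply ht, restrict_restrict hft,
    lintegral_normDet_eq_euclideanHausdorffMeasure_image (hft.inter hs)
      (fun x hx => (hf' x hx.2).mono inter_subset_right) (fun x hx => hinj x hx.2)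
      (hf.mono inter_subset_right),
    image_preimage_inter]

/-- Push-forward form of the area formula, in terms of the restricted map `s.restrict f` (as
Mathlib's `restrict_map_withDensity_abs_det_fderiv_eq_addHaar`): the image of
`J(f') · vol ⌞ s` under `f|s` is `𝓗ᵈ ⌞ f(s)`. [cite: Federer1969, 3.2.3, 3.2.5] -/
theorem restrict_map_withDensity_normDet (hs : MeasurableSet s)
    (hf' : ∀ x ∈ s, HasFDerivWithinAt f (f' x) s x) (hinj : ∀ x ∈ s, Injective (f' x))
    (hf : InjOn f s) :
    Measure.map (s.restrict f)
        (comap (↑) ((volume : Measure P).withDensity fun x =>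
          ENNReal.ofReal (f' x : P →ₗ[ℝ] V).normDet)) =
      (μHE[finrank ℝ P] : Measure V).restrict (f '' s) := by
  obtain ⟨u, u_meas, uf⟩ : ∃ u, Measurable u ∧ EqOn u f s := by
    classical
    refine ⟨piecewise s f 0, ?_, piecewise_eqOn _ _ _⟩
    refine ContinuousOn.measurable_piecewise ?_ continuous_zero.continuousOn hs
    have : DifferentiableOn ℝ f s := fun x hx => (hf' x hx).differentiableWithinAt
    exact this.continuousOn
  have u' : ∀ x ∈ s, HasFDerivWithinAt u (f' x) s x := fun x hx =>
    (hf' x hx).congr (fun y hy => uf hy) (uf hx)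
  set F : s → V := u ∘ (↑) with hF
  have A :
    Measure.map F (comap (↑) ((volume : Measure P).withDensity fun x =>
        ENNReal.ofReal (f' x : P →ₗ[ℝ] V).normDet)) =
      (μHE[finrank ℝ P] : Measure V).restrict (u '' s) := by
    rw [hF, ← Measure.map_map u_meas measurable_subtype_coe, map_comap_subtype_coe hs,
      restrict_withDensity hs]
    exact map_withDensity_normDet_eq_euclideanHausdorffMeasure hs u' hinj (hf.congr uf.symm)
      u_meas
  rw [uf.image_eq] at A
  have : F = s.restrict f := by
    ext x
    exact uf x.2
  rwa [this] at A

/-- **Change of variables, `∫⁻` version**: for `f` injective and differentiable on the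
measurable set `s` with injective differential and `g : V → ℝ≥0∞`,
**`∫_{f(s)} g d𝓗ᵈ = ∫_s J(f' x) g(f x) dx`** (Federer 3.2.5 for injective `f`; measurability of
`f(s)`: `measurableSet_image_of_hasFDerivWithinAt`). [cite: Federer1969, 3.2.5] -/
theorem lintegral_image_eq_lintegral_normDet_mul (hs : MeasurableSet s)
    (hf' : ∀ x ∈ s, HasFDerivWithinAt f (f' x) s x) (hinj : ∀ x ∈ s, Injective (f' x))
    (hf : InjOn f s) (g : V → ℝ≥0∞) :
    ∫⁻ y in f '' s, g y ∂(μHE[finrank ℝ P] : Measure V) =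
      ∫⁻ x in s, ENNReal.ofReal (f' x : P →ₗ[ℝ] V).normDet * g (f x) := by
  rw [← restrict_map_withDensity_normDet hs hf' hinj hf,
    (measurableEmbedding_restrict_of_hasFDerivWithinAt hs hf' hf).lintegral_map]
  simp only [Set.restrict_apply, ← Function.comp_apply (f := g)]
  rw [← (MeasurableEmbedding.subtype_coe hs).lintegral_map, map_comap_subtype_coe hs,
    setLIntegral_withDensity_eq_setLIntegral_mul_non_measurable₀ _ _ _ hs]
  · simp only [Pi.mul_apply]
  · simp only [eventually_true, ENNReal.ofReal_lt_top]
  · exact aemeasurable_ofReal_normDet_fderivWithin hs hf'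

/-- **Integrability in the change of variables**: `g` is integrable on `f(s)` for `𝓗ᵈ` iff
`J(f' x) • g(f x)` is integrable on `s` (as Mathlib's
`integrableOn_image_iff_integrableOn_abs_det_fderiv_smul`). [cite: Federer1969, 3.2.5] -/
theorem integrableOn_image_iff_integrableOn_normDet_smul {G : Type*} [NormedAddCommGroup G]
    [NormedSpace ℝ G] (hs : MeasurableSet s)
    (hf' : ∀ x ∈ s, HasFDerivWithinAt f (f' x) s x) (hinj : ∀ x ∈ s, Injective (f' x))
    (hf : InjOn f s) (g : V → G) :
    IntegrableOn g (f '' s) (μHE[finrank ℝ P] : Measure V) ↔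
      IntegrableOn (fun x => (f' x : P →ₗ[ℝ] V).normDet • g (f x)) s := by
  rw [IntegrableOn, ← restrict_map_withDensity_normDet hs hf' hinj hf,
    (measurableEmbedding_restrict_of_hasFDerivWithinAt hs hf' hf).integrable_map_iff]
  simp only [Set.restrict_eq, ← Function.comp_assoc, ENNReal.ofReal]
  rw [← (MeasurableEmbedding.subtype_coe hs).integrable_map_iff, map_comap_subtype_coe hs,
    restrict_withDensity hs, integrable_withDensity_iff_integrable_coe_smul₀]
  · simp_rw [IntegrableOn, Real.coe_toNNReal _ (LinearMap.normDet_nonneg _), Function.comp_apply]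
  · exact aemeasurable_toNNReal_normDet_fderivWithin hs hf'

/-- **Change of variables, Bochner version**: for `f` injective and differentiable on the
measurable set `s` with injective differential and `g : V → G`,
**`∫_{f(s)} g d𝓗ᵈ = ∫_s J(f' x) • g(f x) dx`** (as Mathlib's
`integral_image_eq_integral_abs_det_fderiv_smul`). [cite: Federer1969, 3.2.5] -/
theorem integral_image_eq_integral_normDet_smul {G : Type*} [NormedAddCommGroup G]
    [NormedSpace ℝ G] (hs : MeasurableSet s)
    (hf' : ∀ x ∈ s, HasFDerivWithinAt f (f' x) s x) (hinj : ∀ x ∈ s, Injective (f' x))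
    (hf : InjOn f s) (g : V → G) :
    ∫ y in f '' s, g y ∂(μHE[finrank ℝ P] : Measure V) =
      ∫ x in s, (f' x : P →ₗ[ℝ] V).normDet • g (f x) := by
  rw [← restrict_map_withDensity_normDet hs hf' hinj hf,
    (measurableEmbedding_restrict_of_hasFDerivWithinAt hs hf' hf).integral_map]
  simp only [Set.restrict_apply, ← Function.comp_apply (f := g), ENNReal.ofReal]
  rw [← (MeasurableEmbedding.subtype_coe hs).integral_map, map_comap_subtype_coe hs,
    setIntegral_withDensity_eq_setIntegral_smul₀
      (aemeasurable_toNNReal_normDet_fderivWithin hs hf') _ hs]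
  congr with x
  rw [NNReal.smul_def, Real.coe_toNNReal _ (LinearMap.normDet_nonneg _)]

end Area

end Literature.Analysis.Calculus
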